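import Literature.Geometry.Riemannian.HeatFlowL2Energy
import Literature.Geometry.Riemannian.ConjugateHeatConservation
import Literature.Analysis.ODE.NashDifferentialInequality
import HarnessLib

/-!
# Nash's `L¹ → L²` smoothing for heat and conjugate heat flows along a Ricci flow

J. Nash (1958) / E. B. Davies, *Heat kernels and spectral theory* (1989), §2.4: the `L²`-energy
identity and Nash's inequality give `‖u(t)‖₂² ≤ C t^{-n/2} ‖u(0)‖₁²` for nonnegative solutions
of the heat equation, with `C` depending only on the constants of Nash's inequality, the bound on
the zeroth-order coefficient and the length of the time interval. Along a Ricci flow `(g, cov)` of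
Riemannian metrics on `[0, T']` on a closed manifold modelled on `ℝᵐ` (`∂ₜ dV = −R dV`,
`|R| ≤ C₀`), given Nash's inequality with time-independent constants `A ≥ 1`, `B ≥ 0`
(`IsRicciFlow.exists_uniform_nash_const` supplies them), we prove:

* `IsRicciFlow.integral_sq_heat_le` — for a heat solution `w ≥ 0` on `[0, T']` and `t ∈ (0, T']`,
  `∫ w(t)² dV_t ≤ e^{(2B/A + C₀)T'} (mA/4)^{m/2} e^{2C₀T'} · t^{−m/2} · (∫ w(0) dV_0)²`;
* `IsRicciFlow.integral_sq_conjugateHeat_le` — for a conjugate heat solution `v ≥ 0` on `[0, T']`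
  and `s ∈ [0, T')`,
  `∫ v(s)² dV_s ≤ e^{(2B/A + C₀)T'} (mA/4)^{m/2} · (T' − s)^{−m/2} · (∫ v(T') dV_{T'})²`.

Proof: `E(t) = ∫ w(t)² dV_t` has `E' = −2∫|∇w|² − ∫Rw²` (`HeatFlowL2Energy.lean`), the mass
`∫ w dV_t ≤ e^{C₀t} ∫ w(0) dV_0`, and Nash's inequality turns this into
`E' ≤ −c E^{1+2/m} + C₁E`, solved by `nash_ode_bound` (`NashDifferentialInequality.lean`); the
conjugate case is the time-reversed argument with constant mass. Everything is proved; no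
definitions, no named facts.

## References

* J. Nash, *Continuity of solutions of parabolic and elliptic equations*, Amer. J. Math. 80
  (1958), 931–954.
* E. B. Davies, *Heat kernels and spectral theory*, Cambridge Tracts in Math. 92 (1989), §2.4.
* P. Topping, *Lectures on the Ricci flow*, LMS Lecture Note Series 325 (2006), (2.5.7).
  [Topping2006]
-/

noncomputable section

open Bundle Set Function Filter Manifold MeasureTheory Measure TopologicalSpace
open scoped Manifold ContDiff Topology ENNReal NNReal

namespace Literature.Geometry.Riemannian

open Lorentzian Lorentzian.PseudoRiemannianMetric Literature.Analysis.ODE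

section NashSmoothing

variable {m : ℕ} {H : Type*} [TopologicalSpace H]
  {I : ModelWithCorners ℝ (EuclideanSpace ℝ (Fin m)) H} [I.Boundaryless]
  {M : Type*} [TopologicalSpace M] [ChartedSpace H M] [IsManifold I ∞ M]
  [T2Space M] [CompactSpace M] [MeasurableSpace M] [BorelSpace M]
  {g : ℝ → PseudoRiemannianMetric I ∞ (EuclideanSpace ℝ (Fin m)) (TangentSpace I : M → Type _)}
  {cov : ℝ → CovariantDerivative I (EuclideanSpace ℝ (Fin m)) (TangentSpace I : M → Type _)}

/-- The constant of Nash's bound: `(α c τ)^{−1/α}` with `α = 2/m`, `c = (2/A) m̄^{−4/m}` equals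
`(mA/4)^{m/2} m̄² τ^{−m/2}` (`m̄, τ > 0`, `A > 0`). [folklore] -/
theorem nash_constant_eq {m : ℕ} (hm : 0 < m) {A mbar τ : ℝ} (hA : 0 < A) (hmbar : 0 < mbar)
    (hτ : 0 < τ) :
    (2 / (m : ℝ) * (2 / A * mbar ^ (-(4 / (m : ℝ)))) * τ) ^ (-(1 / (2 / (m : ℝ)))) =
      ((m : ℝ) * A / 4) ^ ((m : ℝ) / 2) * mbar ^ 2 * τ ^ (-((m : ℝ) / 2)) := by
  have hmR : (0 : ℝ) < m := by exact_mod_cast hm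
  have h1 : -(1 / (2 / (m : ℝ))) = -((m : ℝ) / 2) := by field_simp
  rw [h1]
  have hpow0 : 0 ≤ mbar ^ (-(4 / (m : ℝ))) := Real.rpow_nonneg hmbar.le _
  have hsplit : 2 / (m : ℝ) * (2 / A * mbar ^ (-(4 / (m : ℝ)))) * τ =
      (4 / ((m : ℝ) * A)) * mbar ^ (-(4 / (m : ℝ))) * τ := by
    field_simp
    ring
  rw [hsplit, Real.mul_rpow (by positivity) hτ.le, Real.mul_rpow (by positivity) hpow0,
    ← Real.rpow_mul hmbar.le]
  have h2 : -(4 / (m : ℝ)) * -((m : ℝ) / 2) = 2 := by field_simp; ring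
  rw [h2, Real.rpow_two]
  have h3 : (4 / ((m : ℝ) * A)) ^ (-((m : ℝ) / 2)) = ((m : ℝ) * A / 4) ^ ((m : ℝ) / 2) := by
    rw [Real.rpow_neg (by positivity), ← Real.inv_rpow (by positivity), inv_div]
  rw [h3]

/-- **Nash's `L¹ → L²` bound for heat solutions along a Ricci flow.** Let `(g, cov)` be a Ricci
flow of Riemannian metrics on `[0, T']`, `T' > 0`, on a closed manifold modelled on `ℝᵐ`, `m ≥ 1`,
with `|R| ≤ C₀` on `M × [0, T']` and Nash's inequality with constants `A ≥ 1`, `B ≥ 0` at every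
time of `[0, T']`. Then every heat solution `w ≥ 0` on `[0, T']` satisfies, for `t ∈ (0, T']`,
`∫ w(t)² dV_t ≤ e^{(2B/A + C₀)T'} (mA/4)^{m/2} e^{2C₀T'} t^{−m/2} (∫ w(0) dV_0)²`.
[cite: Topping2006, (2.5.7)] -/
theorem IsRicciFlow.integral_sq_heat_le {T' : ℝ} (hT' : 0 < T')
    (hflow : IsRicciFlow g cov (Icc 0 T')) (hR' : ∀ r, (g r).IsRiemannian) (hm : 0 < m)
    {C₀ : ℝ} (hC₀ : 0 ≤ C₀)
    (hRC₀ : ∀ t ∈ Icc 0 T', ∀ x, |(g t).scalarCurvatureWith (cov t) x| ≤ C₀)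
    {A B : ℝ} (hA : 1 ≤ A) (hB : 0 ≤ B)
    (hNash : ∀ t ∈ Icc 0 T', ∀ w : M → ℝ, ContMDiff I 𝓘(ℝ, ℝ) ∞ w →
      (∫ x, w x ^ 2 ∂(g t).riemVolume) ^ (1 + 2 / (m : ℝ)) ≤
        (∫ x, |w x| ∂(g t).riemVolume) ^ (4 / (m : ℝ)) *
          (A * ∫ x, (g t).gradSq w x ∂(g t).riemVolume + B * ∫ x, w x ^ 2 ∂(g t).riemVolume))
    {w : ℝ → M → ℝ} (hw : IsHeatSolutionOn g w 0 T') (hw0 : ∀ t ∈ Icc 0 T', ∀ x, 0 ≤ w t x)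
    {t : ℝ} (ht : t ∈ Ioc 0 T') :
    ∫ x, w t x ^ 2 ∂(g t).riemVolume ≤
      Real.exp ((2 * B / A + C₀) * T') * (((m : ℝ) * A / 4) ^ ((m : ℝ) / 2)) *
        Real.exp (2 * C₀ * T') * t ^ (-((m : ℝ) / 2)) * (∫ x, w 0 x ∂(g 0).riemVolume) ^ 2 := by
  have hR : ∀ r ∈ Icc 0 T', (g r).IsRiemannian := fun r _ ↦ hR' r
  have htT : t ∈ Icc 0 T' := ⟨ht.1.le, ht.2⟩
  have h0T : (0 : ℝ) ∈ Icc 0 T' := ⟨le_rfl, hT'.le⟩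
  have hmR : (0 : ℝ) < m := by exact_mod_cast hm
  have hA0 : 0 < A := one_pos.trans_le hA
  have ht0 : 0 < t := ht.1
  haveI : ∀ r, IsFiniteMeasure (g r).riemVolume := fun r ↦ ⟨(g r).riemVolume_univ_lt_top⟩
  haveI : ∀ r, (g r).riemVolume.IsOpenPosMeasure := fun r ↦ by
    rw [riemVolume_eq (hR' r)]; exact isOpenPosMeasure_riemannianMeasure _
  -- notation
  set E : ℝ → ℝ := fun r ↦ ∫ x, w r x ^ 2 ∂(g r).riemVolume with hE
  set mass : ℝ → ℝ := fun r ↦ ∫ x, w r x ∂(g r).riemVolume with hmass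
  set m₀ : ℝ := mass 0 with hm₀
  have hslice : ∀ r ∈ Icc 0 T', ContMDiff I 𝓘(ℝ, ℝ) ∞ (w r) := fun r hr ↦ hw.contMDiff_slice hr
  have hwc : ∀ r ∈ Icc 0 T', Continuous (w r) := fun r hr ↦ (hslice r hr).continuous
  have hint : ∀ r ∈ Icc 0 T', ∀ {f : M → ℝ}, Continuous f → Integrable f (g r).riemVolume :=
    fun r _ f hf ↦ hf.integrable_of_hasCompactSupport (HasCompactSupport.of_compactSpace _)
  have hm₀0 : 0 ≤ m₀ := integral_nonneg fun x ↦ hw0 0 h0T x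
  have hRHS0 : 0 ≤ Real.exp ((2 * B / A + C₀) * T') * (((m : ℝ) * A / 4) ^ ((m : ℝ) / 2)) *
      Real.exp (2 * C₀ * T') * t ^ (-((m : ℝ) / 2)) := by positivity
  -- a vanishing slice propagates: if `w r₀ = 0` then `w = 0` later
  have hzero : ∀ r₀ ∈ Icc 0 T', (∀ x, w r₀ x = 0) → ∀ r ∈ Icc r₀ T', ∀ x, w r x = 0 := by
    intro r₀ hr₀ hz r hr x
    rcases eq_or_lt_of_le hr₀.2 with h | h
    · have : r = T' := le_antisymm hr.2 (h ▸ hr.1)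
      subst this
      rw [← h]; exact hz x
    · have hw' : IsHeatSolutionOn g w r₀ T' := hw.mono hr₀.1 le_rfl
      have h0 : IsHeatSolutionOn g (fun r y ↦ 0 * w r y) r₀ T' := hw'.const_mul 0
      have := IsHeatSolutionOn.unique hR' h hw' h0 (funext fun y ↦ by simp [hz y]) hr x
      simpa using this
  -- trivial case `E t = 0`
  by_cases hEt : E t = 0
  · show E t ≤ _
    rw [hEt]
    positivity
  -- otherwise `E > 0` on `[0, t]`
  have hEnn : ∀ r ∈ Icc 0 T', 0 ≤ E r := fun r _ ↦ integral_nonneg fun x ↦ sq_nonneg _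
  have hEpos : ∀ r ∈ Icc 0 t, 0 < E r := by
    intro r hr
    have hr' : r ∈ Icc 0 T' := ⟨hr.1, hr.2.trans ht.2⟩
    refine (hEnn r hr').lt_of_ne fun h0 ↦ hEt ?_
    -- `w r = 0`, hence `w t = 0`
    have hwr : ∀ x, w r x = 0 := by
      have h1 := (integral_eq_zero_iff_of_nonneg (fun x ↦ sq_nonneg (w r x))
        (hint r hr' ((hwc r hr').pow 2))).1 h0.symm
      have h2 : (fun x ↦ w r x ^ 2) = fun _ ↦ 0 :=
        Measure.eq_of_ae_eq h1 ((hwc r hr').pow 2) continuous_const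
      intro x
      have := congrFun h2 x
      simpa using this
    have hwt : ∀ x, w t x = 0 := hzero r hr' hwr t ⟨hr.2, ht.2⟩
    show ∫ x, w t x ^ 2 ∂(g t).riemVolume = 0
    simp [hwt]
  -- `m₀ > 0` (else `w 0 = 0` and `E t = 0`)
  have hm₀pos : 0 < m₀ := by
    refine hm₀0.lt_of_ne fun h0 ↦ hEt ?_
    have hw00 : ∀ x, w 0 x = 0 := by
      have h1 := (integral_eq_zero_iff_of_nonneg (fun x ↦ hw0 0 h0T x) (hint 0 h0T (hwc 0 h0T))).1
        h0.symm
      exact congrFun (Measure.eq_of_ae_eq h1 (hwc 0 h0T) continuous_const)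
    have hwt : ∀ x, w t x = 0 := hzero 0 h0T hw00 t htT
    show ∫ x, w t x ^ 2 ∂(g t).riemVolume = 0
    simp [hwt]
  -- the mass bound `mass r ≤ m̄ = e^{C₀T'} m₀`
  set mbar : ℝ := Real.exp (C₀ * T') * m₀ with hmbar
  have hmbar_pos : 0 < mbar := mul_pos (Real.exp_pos _) hm₀pos
  have hmass_le : ∀ r ∈ Icc 0 T', mass r ≤ mbar := by
    intro r hr
    have h1 := hflow.integral_heat_le_exp_mul_integral hT' hR hw hw0 hRC₀ hr
    refine h1.trans (mul_le_mul_of_nonneg_right (Real.exp_le_exp.2 ?_) hm₀0)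
    exact mul_le_mul_of_nonneg_left hr.2 hC₀
  -- the differential inequality on `[0, t]`
  set c : ℝ := 2 / A * mbar ^ (-(4 / (m : ℝ))) with hc
  have hcpos : 0 < c := by positivity
  set C₁ : ℝ := 2 * B / A + C₀ with hC₁
  have hC₁0 : 0 ≤ C₁ := by positivity
  set E' : ℝ → ℝ := fun r ↦ -2 * ∫ x, (g r).gradSq (w r) x ∂(g r).riemVolume -
    ∫ x, (g r).scalarCurvatureWith (cov r) x * w r x ^ 2 ∂(g r).riemVolume with hE'
  have hEd : ∀ r ∈ Icc 0 t, HasDerivWithinAt E (E' r) (Icc 0 t) r := fun r hr ↦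
    (hflow.hasDerivWithinAt_integral_sq_heat hT' hR hw ⟨hr.1, hr.2.trans ht.2⟩).mono
      (Icc_subset_Icc le_rfl ht.2)
  have hEc : ContinuousOn E (Icc 0 t) := fun r hr ↦ (hEd r hr).continuousWithinAt
  have hineq : ∀ r ∈ Icc 0 t, E' r ≤ -c * E r ^ (1 + 2 / (m : ℝ)) + C₁ * E r := by
    intro r hr
    have hr' : r ∈ Icc 0 T' := ⟨hr.1, hr.2.trans ht.2⟩
    set G : ℝ := ∫ x, (g r).gradSq (w r) x ∂(g r).riemVolume with hG
    -- `|∫ R w²| ≤ C₀ E`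
    have hRw : -(∫ x, (g r).scalarCurvatureWith (cov r) x * w r x ^ 2 ∂(g r).riemVolume) ≤
        C₀ * E r := by
      rw [← integral_neg, show C₀ * E r = ∫ x, C₀ * w r x ^ 2 ∂(g r).riemVolume from
        (integral_const_mul _ _).symm]
      have hRc : Continuous fun x ↦ (g r).scalarCurvatureWith (cov r) x :=
        (contMDiff_slice_of_contMDiffOn
          (u := fun r x ↦ (g r).scalarCurvatureWith (cov r) x)
          hflow.contMDiffOn_scalarCurvatureWith hr').continuous
      refine integral_mono ((hint r hr' (hRc.mul ((hwc r hr').pow 2))).neg)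
        ((hint r hr' ((hwc r hr').pow 2)).const_mul C₀) fun x ↦ ?_
      have h1 := hRC₀ r hr' x
      have h2 : 0 ≤ w r x ^ 2 := sq_nonneg _
      have h3 := neg_abs_le ((g r).scalarCurvatureWith (cov r) x)
      show -((g r).scalarCurvatureWith (cov r) x * w r x ^ 2) ≤ C₀ * w r x ^ 2
      nlinarith
    -- Nash at time `r` for the slice `w r` (mass `= ∫ |w r| = mass r ≤ mbar`)
    have hN := hNash r hr' (w r) (hslice r hr')
    have habs : ∫ x, |w r x| ∂(g r).riemVolume = mass r :=
      integral_congr_ae (Eventually.of_forall fun x ↦ abs_of_nonneg (hw0 r hr' x))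
    rw [habs] at hN
    have hmass0 : 0 ≤ mass r := integral_nonneg fun x ↦ hw0 r hr' x
    have hN' : E r ^ (1 + 2 / (m : ℝ)) ≤ mbar ^ (4 / (m : ℝ)) * (A * G + B * E r) := by
      refine hN.trans (mul_le_mul_of_nonneg_right
        (Real.rpow_le_rpow hmass0 (hmass_le r hr') (by positivity)) ?_)
      have hG0 : 0 ≤ G := integral_nonneg fun x ↦ gradSq_nonneg (g r) (hR' r) (w r) x
      have := hEnn r hr'
      positivity
    -- `E^{1+2/m} mbar^{-4/m} ≤ A G + B E`
    have hN'' : E r ^ (1 + 2 / (m : ℝ)) * mbar ^ (-(4 / (m : ℝ))) ≤ A * G + B * E r := by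
      rw [Real.rpow_neg hmbar_pos.le, ← div_eq_mul_inv, div_le_iff₀ (Real.rpow_pos_of_pos hmbar_pos _)]
      linarith [hN']
    show E' r ≤ -c * E r ^ (1 + 2 / (m : ℝ)) + C₁ * E r
    simp only [hE', hc, hC₁]
    have hGdef : ∫ x, (g r).gradSq (w r) x ∂(g r).riemVolume = G := rfl
    rw [hGdef]
    -- `−2G ≤ −(2/A)(E^{1+α} mbar^{−4/m}) + (2B/A) E`
    have h2 : -2 * G ≤ -(2 / A) * (E r ^ (1 + 2 / (m : ℝ)) * mbar ^ (-(4 / (m : ℝ)))) +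
        2 * B / A * E r := by
      have := div_le_div_of_nonneg_right (c := A) hN'' hA0.le
      rw [show (A * G + B * E r) / A = G + B / A * E r by field_simp] at this
      have h3 : -(2 / A) * (E r ^ (1 + 2 / (m : ℝ)) * mbar ^ (-(4 / (m : ℝ)))) =
          -(2 * ((E r ^ (1 + 2 / (m : ℝ)) * mbar ^ (-(4 / (m : ℝ)))) / A)) := by ring
      have h4 : 2 * B / A * E r = 2 * (B / A * E r) := by ring
      rw [h3, h4]
      linarith
    linarith
  -- Nash's ODE bound on `[0, t]`
  have key := nash_ode_bound (s := 0) ht.1 hcpos (by positivity : (0 : ℝ) < 2 / (m : ℝ)) hC₁0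
    hEc hEpos hEd hineq
  rw [sub_zero] at key
  -- rewrite the constant
  have hconst := nash_constant_eq hm hA0 hmbar_pos ht.1
  rw [hconst] at key
  have hmbar2 : mbar ^ 2 = Real.exp (2 * C₀ * T') * m₀ ^ 2 := by
    rw [hmbar, mul_pow, ← Real.exp_nat_mul]; ring_nf
  rw [hmbar2] at key
  have hexp : Real.exp (C₁ * t) ≤ Real.exp (C₁ * T') :=
    Real.exp_le_exp.2 (mul_le_mul_of_nonneg_left ht.2 hC₁0)
  calc E t ≤ Real.exp (C₁ * t) * (((m : ℝ) * A / 4) ^ ((m : ℝ) / 2) *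
        (Real.exp (2 * C₀ * T') * m₀ ^ 2) * t ^ (-((m : ℝ) / 2))) := key
    _ ≤ Real.exp (C₁ * T') * (((m : ℝ) * A / 4) ^ ((m : ℝ) / 2) *
        (Real.exp (2 * C₀ * T') * m₀ ^ 2) * t ^ (-((m : ℝ) / 2))) :=
        mul_le_mul_of_nonneg_right hexp (by positivity)
    _ = _ := by rw [hC₁]; ring


/-- **Nash's `L¹ → L²` bound for conjugate heat solutions along a Ricci flow (backward).** In the
setting of `IsRicciFlow.integral_sq_heat_le`, every conjugate heat solution `v ≥ 0` on `[0, T']`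
(`∂ₜv = −Δv + Rv`, constant mass `∫ v dV_t`) satisfies, for `s ∈ [0, T')`,
`∫ v(s)² dV_s ≤ e^{(2B/A + C₀)T'} (mA/4)^{m/2} (T' − s)^{−m/2} (∫ v(T') dV_{T'})²`.
[cite: Topping2006, (2.5.7)] -/
theorem IsRicciFlow.integral_sq_conjugateHeat_le {T' : ℝ} (hT' : 0 < T')
    (hflow : IsRicciFlow g cov (Icc 0 T')) (hR' : ∀ r, (g r).IsRiemannian) (hm : 0 < m)
    {C₀ : ℝ} (hC₀ : 0 ≤ C₀)
    (hRC₀ : ∀ t ∈ Icc 0 T', ∀ x, |(g t).scalarCurvatureWith (cov t) x| ≤ C₀)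
    {A B : ℝ} (hA : 1 ≤ A) (hB : 0 ≤ B)
    (hNash : ∀ t ∈ Icc 0 T', ∀ w : M → ℝ, ContMDiff I 𝓘(ℝ, ℝ) ∞ w →
      (∫ x, w x ^ 2 ∂(g t).riemVolume) ^ (1 + 2 / (m : ℝ)) ≤
        (∫ x, |w x| ∂(g t).riemVolume) ^ (4 / (m : ℝ)) *
          (A * ∫ x, (g t).gradSq w x ∂(g t).riemVolume + B * ∫ x, w x ^ 2 ∂(g t).riemVolume))
    {v : ℝ → M → ℝ} (hv : IsConjugateHeatSolutionOn g cov (Icc 0 T') v)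
    (hv0 : ∀ t ∈ Icc 0 T', ∀ x, 0 ≤ v t x) {s : ℝ} (hs : s ∈ Ico 0 T') :
    ∫ x, v s x ^ 2 ∂(g s).riemVolume ≤
      Real.exp ((2 * B / A + C₀) * T') * (((m : ℝ) * A / 4) ^ ((m : ℝ) / 2)) *
        (T' - s) ^ (-((m : ℝ) / 2)) * (∫ x, v T' x ∂(g T').riemVolume) ^ 2 := by
  have hR : ∀ r ∈ Icc 0 T', (g r).IsRiemannian := fun r _ ↦ hR' r
  have hsT : s ∈ Icc 0 T' := ⟨hs.1, hs.2.le⟩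
  have hTT : T' ∈ Icc 0 T' := ⟨hT'.le, le_rfl⟩
  have hmR : (0 : ℝ) < m := by exact_mod_cast hm
  have hA0 : 0 < A := one_pos.trans_le hA
  have hτ0 : 0 < T' - s := sub_pos.2 hs.2
  haveI : ∀ r, IsFiniteMeasure (g r).riemVolume := fun r ↦ ⟨(g r).riemVolume_univ_lt_top⟩
  haveI : ∀ r, (g r).riemVolume.IsOpenPosMeasure := fun r ↦ by
    rw [riemVolume_eq (hR' r)]; exact isOpenPosMeasure_riemannianMeasure _
  set E : ℝ → ℝ := fun r ↦ ∫ x, v r x ^ 2 ∂(g r).riemVolume with hE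
  set Mv : ℝ := ∫ x, v T' x ∂(g T').riemVolume with hMv
  have hslice : ∀ r ∈ Icc 0 T', ContMDiff I 𝓘(ℝ, ℝ) ∞ (v r) := fun r hr ↦
    contMDiff_slice_of_contMDiffOn hv.1 hr
  have hvc : ∀ r ∈ Icc 0 T', Continuous (v r) := fun r hr ↦ (hslice r hr).continuous
  have hint : ∀ r ∈ Icc 0 T', ∀ {f : M → ℝ}, Continuous f → Integrable f (g r).riemVolume :=
    fun r _ f hf ↦ hf.integrable_of_hasCompactSupport (HasCompactSupport.of_compactSpace _)
  -- constant mass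
  have hmass : ∀ r ∈ Icc 0 T', ∫ x, v r x ∂(g r).riemVolume = Mv := fun r hr ↦
    hflow.integral_conjugateHeat_eq_Icc hT' hR hv.1 hv.2 hr
  have hMv0 : 0 ≤ Mv := integral_nonneg fun x ↦ hv0 T' hTT x
  have hRHS0 : 0 ≤ Real.exp ((2 * B / A + C₀) * T') * (((m : ℝ) * A / 4) ^ ((m : ℝ) / 2)) *
      (T' - s) ^ (-((m : ℝ) / 2)) := by positivity
  -- a slice with zero mass vanishes
  have hvanish : ∀ r ∈ Icc 0 T', Mv = 0 → ∀ x, v r x = 0 := by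
    intro r hr h0
    have h1 := (integral_eq_zero_iff_of_nonneg (fun x ↦ hv0 r hr x) (hint r hr (hvc r hr))).1
      ((hmass r hr).trans h0)
    exact congrFun (Measure.eq_of_ae_eq h1 (hvc r hr) continuous_const)
  -- trivial case `Mv = 0`
  rcases hMv0.eq_or_lt with hM0 | hMpos
  · have hvs : ∀ x, v s x = 0 := hvanish s hsT hM0.symm
    show E s ≤ _
    have : E s = 0 := by show ∫ x, v s x ^ 2 ∂(g s).riemVolume = 0; simp [hvs]
    rw [this]
    positivity
  -- `E > 0` on `[s, T']`
  have hEnn : ∀ r ∈ Icc 0 T', 0 ≤ E r := fun r _ ↦ integral_nonneg fun x ↦ sq_nonneg _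
  have hEpos : ∀ r ∈ Icc s T', 0 < E r := by
    intro r hr
    have hr' : r ∈ Icc 0 T' := ⟨hs.1.trans hr.1, hr.2⟩
    refine (hEnn r hr').lt_of_ne fun h0 ↦ hMpos.ne' ?_
    have h1 := (integral_eq_zero_iff_of_nonneg (fun x ↦ sq_nonneg (v r x))
      (hint r hr' ((hvc r hr').pow 2))).1 h0.symm
    have h2 : (fun x ↦ v r x ^ 2) = fun _ ↦ 0 :=
      Measure.eq_of_ae_eq h1 ((hvc r hr').pow 2) continuous_const
    have hvr : ∀ x, v r x = 0 := fun x ↦ by simpa using congrFun h2 x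
    rw [← hmass r hr']
    simp [hvr]
  -- the differential inequality on `[s, T']`
  set c : ℝ := 2 / A * Mv ^ (-(4 / (m : ℝ))) with hc
  have hcpos : 0 < c := by positivity
  set C₁ : ℝ := 2 * B / A + C₀ with hC₁
  have hC₁0 : 0 ≤ C₁ := by positivity
  set E' : ℝ → ℝ := fun r ↦ 2 * ∫ x, (g r).gradSq (v r) x ∂(g r).riemVolume +
    ∫ x, (g r).scalarCurvatureWith (cov r) x * v r x ^ 2 ∂(g r).riemVolume with hE'
  have hEd : ∀ r ∈ Icc s T', HasDerivWithinAt E (E' r) (Icc s T') r := fun r hr ↦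
    (hflow.hasDerivWithinAt_integral_sq_conjugateHeat hT' hR hv ⟨hs.1.trans hr.1, hr.2⟩).mono
      (Icc_subset_Icc hs.1 le_rfl)
  have hEc : ContinuousOn E (Icc s T') := fun r hr ↦ (hEd r hr).continuousWithinAt
  have hineq : ∀ r ∈ Icc s T', c * E r ^ (1 + 2 / (m : ℝ)) - C₁ * E r ≤ E' r := by
    intro r hr
    have hr' : r ∈ Icc 0 T' := ⟨hs.1.trans hr.1, hr.2⟩
    set G : ℝ := ∫ x, (g r).gradSq (v r) x ∂(g r).riemVolume with hG
    have hRv : -(C₀ * E r) ≤ ∫ x, (g r).scalarCurvatureWith (cov r) x * v r x ^ 2 ∂(g r).riemVolume := by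
      rw [show -(C₀ * E r) = ∫ x, -(C₀ * v r x ^ 2) ∂(g r).riemVolume by
        rw [integral_neg, integral_const_mul]]
      have hRc : Continuous fun x ↦ (g r).scalarCurvatureWith (cov r) x :=
        (contMDiff_slice_of_contMDiffOn
          (u := fun r x ↦ (g r).scalarCurvatureWith (cov r) x)
          hflow.contMDiffOn_scalarCurvatureWith hr').continuous
      refine integral_mono ((hint r hr' ((hvc r hr').pow 2)).const_mul C₀).neg
        (hint r hr' (hRc.mul ((hvc r hr').pow 2))) fun x ↦ ?_
      have h1 := hRC₀ r hr' x
      have h2 : 0 ≤ v r x ^ 2 := sq_nonneg _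
      have h3 := neg_abs_le ((g r).scalarCurvatureWith (cov r) x)
      show -(C₀ * v r x ^ 2) ≤ (g r).scalarCurvatureWith (cov r) x * v r x ^ 2
      nlinarith
    have hN := hNash r hr' (v r) (hslice r hr')
    have habs : ∫ x, |v r x| ∂(g r).riemVolume = Mv := by
      rw [← hmass r hr']
      exact integral_congr_ae (Eventually.of_forall fun x ↦ abs_of_nonneg (hv0 r hr' x))
    rw [habs] at hN
    have hN'' : E r ^ (1 + 2 / (m : ℝ)) * Mv ^ (-(4 / (m : ℝ))) ≤ A * G + B * E r := by
      rw [Real.rpow_neg hMpos.le, ← div_eq_mul_inv, div_le_iff₀ (Real.rpow_pos_of_pos hMpos _)]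
      linarith [hN]
    show c * E r ^ (1 + 2 / (m : ℝ)) - C₁ * E r ≤ E' r
    simp only [hE', hc, hC₁]
    have hGdef : ∫ x, (g r).gradSq (v r) x ∂(g r).riemVolume = G := rfl
    rw [hGdef]
    have h2 : 2 / A * Mv ^ (-(4 / (m : ℝ))) * E r ^ (1 + 2 / (m : ℝ)) - 2 * B / A * E r ≤ 2 * G := by
      have := div_le_div_of_nonneg_right (c := A) hN'' hA0.le
      rw [show (A * G + B * E r) / A = G + B / A * E r by field_simp] at this
      have h3 : 2 / A * Mv ^ (-(4 / (m : ℝ))) * E r ^ (1 + 2 / (m : ℝ)) =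
          2 * (E r ^ (1 + 2 / (m : ℝ)) * Mv ^ (-(4 / (m : ℝ))) / A) := by ring
      have h4 : 2 * B / A * E r = 2 * (B / A * E r) := by ring
      rw [h3, h4]
      linarith
    linarith
  -- Nash's ODE bound, backward on `[s, T']`
  have key := nash_ode_bound_backward hs.2 hcpos (by positivity : (0 : ℝ) < 2 / (m : ℝ)) hC₁0
    hEc hEpos hEd hineq
  have hconst := nash_constant_eq hm hA0 hMpos hτ0
  rw [hconst] at key
  have hexp : Real.exp (C₁ * (T' - s)) ≤ Real.exp (C₁ * T') :=
    Real.exp_le_exp.2 (mul_le_mul_of_nonneg_left (by linarith [hs.1]) hC₁0)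
  calc E s ≤ Real.exp (C₁ * (T' - s)) * (((m : ℝ) * A / 4) ^ ((m : ℝ) / 2) * Mv ^ 2 *
        (T' - s) ^ (-((m : ℝ) / 2))) := key
    _ ≤ Real.exp (C₁ * T') * (((m : ℝ) * A / 4) ^ ((m : ℝ) / 2) * Mv ^ 2 *
        (T' - s) ^ (-((m : ℝ) / 2))) := mul_le_mul_of_nonneg_right hexp (by positivity)
    _ = _ := by rw [hC₁]; ring

end NashSmoothing

end Literature.Geometry.Riemannian

end
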